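import Literature.IUT.HodgeTheaters.PiAvatarOrbitCategoryProofs
import Mathlib.GroupTheory.QuotientGroup.Basic
import HarnessLib

/-!
# `Aut(ℬ(H)⁰) ≅ N_A(H)/H` as a group isomorphism in the Π-avatar orbit category (KIT-INSTANCE-SPEC P5-core, defs;
# post-freeze additive D13 — not a cone member)

S. Mochizuki, *Inter-universal Teichmüller theory I*, kurims manuscript (May 2020), §0 p. 33 (automorphisms of a
connected anabelioid `ℬ(Π)⁰` = outer automorphisms), Def 6.1 (v) p. 158 ("`Aut_K(X̲_K) ⥲ Aut_±(𝒟^{⊚±})/Aut_csp(𝒟^{⊚±}) ⥲ 𝔽_l^{⋊±}`",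
"`Aut(𝒟^{⊚±}) ↠ 𝔽_l^⋇`") ([IUTchI] Def 6.1 (v) p.158) [claim: Mochizuki2012, status: disputed] (D-0012 claim key, series
status DISPUTED — group-theoretic PLUMBING for the genuine kit instance; nothing of the series is asserted, no side is
taken on [IUTchIII] Cor. 3.12).

abc-iut-L5-t4's `PiAvatarOrbitCategory*` (p419432/p420087) proved `Aut(A/H) = N_A(H)/H` as existence/uniqueness
statements (`exists_eq_autOfNormalizer`, `autOfNormalizer_eq_iff`).  The kit slot `toFlStar : Aut(†𝒟^{⊚±}) →* 𝔽_l^⋇`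
([IUTchI] Def 6.1 (v)) and the law `gLab_range` need it as a HOMOMORPHISM / ISOMORPHISM, to be composed with
abc-iut-w4-d065's `toFlStarOfNormalizer : ↥(N_A(X) ⊓ N_A(Y)) →* FlStar l` (D13-P3-v).  This file:

* `OrbitCat.autOfNormalizerHom H : ↥N_A(H) →* Aut (of H)`, `n ↦ (xH ↦ xn⁻¹H)` (the inverse makes it a homomorphism for
  Mathlib's `Aut` convention `f * g = g ≫ f`); `autOfNormalizerHom_apply`;
* `mem_ker_autOfNormalizerHom_iff` / `ker_autOfNormalizerHom : ker = H.subgroupOf N_A(H)`; `autOfNormalizerHom_surjective`;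
* `OrbitCat.autEquiv H : ↥N_A(H) ⧸ H.subgroupOf N_A(H) ≃* Aut (of H)` — **`Aut(ℬ(H)⁰) ≅ N_A(H)/H`**.

Definitions over Mathlib only (no instance/notation declared; `noncomputable` where quotient equivalences need it);
typed ≠ proved elsewhere.
-/

namespace Literature.IUT.HodgeTheaters

open CategoryTheory

universe u

namespace OrbitCat

variable {A : Type u} [Group A] (H : Subgroup A)

/-- **`N_A(H) → Aut(ℬ(H)⁰)`, `n ↦ (xH ↦ xn⁻¹H)`** — a group homomorphism onto the automorphism group of the embedded
object (Mathlib's `Aut X` multiplies by `f * g = g ≫ f`, whence the inverse). ([IUTchI] Def 6.1 (v) p.158)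
[claim: Mochizuki2012, status: disputed] -/
noncomputable def autOfNormalizerHom : ↥(Subgroup.normalizer (H : Set A)) →* Aut (of H : OrbitCat A) where
  toFun n := autOfNormalizer (n : A)⁻¹ (Subgroup.inv_mem _ n.2)
  map_one' := by
    change autOfNormalizer _ _ = Iso.refl (of H)
    rw [autOfNormalizer_eq_refl_iff]
    simp
  map_mul' n m := by
    change autOfNormalizer _ _ = (autOfNormalizer _ _) ≪≫ (autOfNormalizer _ _)
    rw [autOfNormalizer_trans, autOfNormalizer_eq_iff]
    simp [mul_assoc]

/-- `autOfNormalizerHom H n` is the automorphism `xH ↦ xn⁻¹H`. ([IUTchI] Def 6.1 (v) p.158) [claim: Mochizuki2012, status: disputed] -/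
theorem autOfNormalizerHom_apply (n : ↥(Subgroup.normalizer (H : Set A))) :
    autOfNormalizerHom H n = autOfNormalizer (n : A)⁻¹ (Subgroup.inv_mem _ n.2) := rfl

/-- The kernel of `N_A(H) → Aut(ℬ(H)⁰)` is `H`: `xH ↦ xn⁻¹H` is the identity iff `n ∈ H`.
([IUTchI] Def 6.1 (v) p.158) [claim: Mochizuki2012, status: disputed] -/
theorem mem_ker_autOfNormalizerHom_iff (n : ↥(Subgroup.normalizer (H : Set A))) :
    n ∈ (autOfNormalizerHom H).ker ↔ (n : A) ∈ H := by
  rw [MonoidHom.mem_ker, autOfNormalizerHom_apply]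
  change autOfNormalizer _ _ = Iso.refl (of H) ↔ _
  rw [autOfNormalizer_eq_refl_iff]
  exact Subgroup.inv_mem_iff H

/-- `ker (N_A(H) → Aut(ℬ(H)⁰)) = H ∩ N_A(H)` (as a subgroup of the normaliser). ([IUTchI] Def 6.1 (v) p.158)
[claim: Mochizuki2012, status: disputed] -/
theorem ker_autOfNormalizerHom :
    (autOfNormalizerHom H).ker = H.subgroupOf (Subgroup.normalizer (H : Set A)) := by
  ext n
  rw [mem_ker_autOfNormalizerHom_iff, Subgroup.mem_subgroupOf]

/-- Every automorphism of `ℬ(H)⁰` comes from the normaliser: `N_A(H) → Aut(ℬ(H)⁰)` is surjective.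
([IUTchI] Def 6.1 (v) p.158) [claim: Mochizuki2012, status: disputed] -/
theorem autOfNormalizerHom_surjective : Function.Surjective (autOfNormalizerHom H) := by
  intro e
  obtain ⟨n, hn, rfl⟩ := exists_eq_autOfNormalizer e
  refine ⟨⟨n⁻¹, Subgroup.inv_mem _ hn⟩, ?_⟩
  rw [autOfNormalizerHom_apply]
  have h : (autOfNormalizer ((⟨n⁻¹, Subgroup.inv_mem _ hn⟩ : ↥(Subgroup.normalizer (H : Set A))) : A)⁻¹
      (Subgroup.inv_mem _ (Subgroup.inv_mem _ hn)) : of H ≅ of H) = autOfNormalizer n hn := by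
    rw [autOfNormalizer_eq_iff]
    simp
  exact h

/-- **`Aut(ℬ(H)⁰) ≅ N_A(H)/H`** ([IUTchI] §0: automorphisms of the connected anabelioid `ℬ(H)⁰` embedded in `ℬ(A)⁰` are the
outer ones realised in the ambient; Def 6.1 (v): `Aut_K(X̲_K) = Gal(X̲_K/C_K)` inside `Π_{C_K}`), as a multiplicative
equivalence from the quotient of the normaliser by `H`. ([IUTchI] Def 6.1 (v) p.158) [claim: Mochizuki2012, status: disputed] -/
noncomputable def autEquiv :
    ↥(Subgroup.normalizer (H : Set A)) ⧸ H.subgroupOf (Subgroup.normalizer (H : Set A)) ≃* Aut (of H : OrbitCat A) :=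
  (QuotientGroup.quotientMulEquivOfEq (ker_autOfNormalizerHom H)).symm.trans
    (QuotientGroup.quotientKerEquivOfSurjective (autOfNormalizerHom H) (autOfNormalizerHom_surjective H))

/-- `autEquiv` on the class of `n` is `xH ↦ xn⁻¹H`. ([IUTchI] Def 6.1 (v) p.158) [claim: Mochizuki2012, status: disputed] -/
theorem autEquiv_mk (n : ↥(Subgroup.normalizer (H : Set A))) :
    autEquiv H (QuotientGroup.mk n) = autOfNormalizerHom H n := by
  change QuotientGroup.quotientKerEquivOfSurjective (autOfNormalizerHom H) (autOfNormalizerHom_surjective H)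
      ((QuotientGroup.quotientMulEquivOfEq (ker_autOfNormalizerHom H)).symm (QuotientGroup.mk n)) = _
  have h1 : (QuotientGroup.quotientMulEquivOfEq (ker_autOfNormalizerHom H)).symm (QuotientGroup.mk n) =
      QuotientGroup.mk n := rfl
  rw [h1]
  exact QuotientGroup.kerLift_mk (autOfNormalizerHom H) n

end OrbitCat

end Literature.IUT.HodgeTheaters
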